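import Summits.ResolutionOfSingularities.ResolutionOfSingularities.Theorems.RadicialJungCleanModelsT2CriticalPrimesStalk
import Literature.AlgebraicGeometry.Resolution.StrictNormalCrossingsAt
import Literature.AlgebraicGeometry.Resolution.QuadraticTransformsKeyLemma
import HarnessLib

/-!
# Route `RadicialJung`, crux `CleanModels` (stmt-15917): the regular parameters of a strict
# normal crossings point of a surface and the critical primes there (T2 brick B5-d, item (d1))

Support file (OURS) for PROGRAMME-clean-dim2 / T2 (`stub_step ≡ stub_lemma23`), line
`via-clean-models` of crux `DescentPerfectToAll` (stmt-0549). Nothing here is a statement of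
Hironaka's manuscript. Item (d1) of res-L0-w81-pv-1's interface (STATUS 21:13:38Z), left open by
the end of res-L0-w81-pv-2 g5's seat:

* `exists_rsop_stalkIdeal_eq_of_isStrictNormalCrossingsAt` — at a point `ξ` of a closed `Z` with
  strict normal crossings at `ξ` and `dim 𝒪_{X,ξ} = 2`: regular parameters `x ≠ y` with
  `𝔪_ξ = (x, y)` and `I(Z)_ξ = (x)` (one branch) or `I(Z)_ξ = (x·y)` (two branches) — unpacking
  `IsSNCIdeal` (`r + e = 2`, `r ≥ 1`);
* `exists_rsop_derivCriticalPrimes_of_isStrictNormalCrossingsAt` — **(d1)**: for `Z = E(f)` and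
  `ξ` in an affine open with `Ω[Γ(X,U)⁄ℤ]` projective, moreover
  `crit(𝒪_{X,ξ}, f_ξ) = {P prime, ht P = 1, g ∈ P}` with `g = x` resp. `g = x·y`
  (`mem_derivCriticalPrimes_stalk_iff_of_eq_span`; res-L0-w81-pv-1's
  `mem_derivCriticalPrimes_iff_of_rsop₁/₂` turn this into the explicit lists `{(x)}`, `{(x),(y)}`).

## References
* J. Giraud, Forme normale d'une fonction sur une surface de caractéristique positive,
  Bull. SMF 111 (1983), Déf. 1.2, 1.3, 2.2 (*). [Giraud1983]
* The Stacks Project, Tag 0BI9. [StacksProject]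
-/

noncomputable section

set_option linter.dupNamespace false -- mandated namespace of this single-conjunct summit

open CategoryTheory AlgebraicGeometry TopologicalSpace IsLocalRing
open Literature.AlgebraicGeometry.Resolution

namespace Summit.ResolutionOfSingularities.ResolutionOfSingularities.Theorems.RadicialJung.CleanModels.T2

open Scheme.IdealSheafData

/-- **The regular parameters at a strict normal crossings point of a surface.** If the closed set
`Z ⊆ X` has strict normal crossings at `ξ` and `dim 𝒪_{X,ξ} = 2`, then `𝒪_{X,ξ}` is regular and
there are `x ≠ y` with `𝔪_ξ = (x, y)` and `I(Z)_ξ = (x)` (one branch) or `I(Z)_ξ = (x·y)` (two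
branches). [cite: StacksProject, Tag 0BI9] -/
theorem exists_rsop_stalkIdeal_eq_of_isStrictNormalCrossingsAt {X : Scheme.{0}} {Z : Set X}
    (hZ : IsClosed Z) {ξ : X} (h : IsStrictNormalCrossingsAt X Z ξ)
    (hdim : ringKrullDim (X.presheaf.stalk ξ) = 2) :
    ∃ x y : X.presheaf.stalk ξ, IsRegularLocalRing (X.presheaf.stalk ξ) ∧ x ≠ y ∧
      maximalIdeal (X.presheaf.stalk ξ) = Ideal.span {x, y} ∧
      (stalkIdeal (vanishingIdeal ⟨Z, hZ⟩) ξ = Ideal.span {x} ∨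
        stalkIdeal (vanishingIdeal ⟨Z, hZ⟩) ξ = Ideal.span {x * y}) := by
  have hcl : (⟨closure Z, isClosed_closure⟩ : Closeds X) = ⟨Z, hZ⟩ := Closeds.ext hZ.closure_eq
  unfold IsStrictNormalCrossingsAt at h
  rw [hcl] at h
  obtain ⟨hreg, r, e, x, y, hr, hdim', hspan, hI⟩ := h
  haveI := hreg
  have hre : r + e = 2 := by
    rw [hdim] at hdim'
    exact_mod_cast hdim'.symm
  -- `x ≠ y` for any pair of generators of `𝔪` (the maximal ideal is not principal)
  have hne : ∀ {a b : X.presheaf.stalk ξ},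
      maximalIdeal (X.presheaf.stalk ξ) = Ideal.span {a, b} → a ≠ b := by
    intro a b hab heq
    rw [heq, Set.pair_eq_singleton] at hab
    exact maximalIdeal_ne_span_singleton hdim b hab
  rcases Nat.lt_or_ge r 2 with hr1 | hr2
  · -- one branch: `r = 1`, `e = 1`
    obtain rfl : r = 1 := by omega
    obtain rfl : e = 1 := by omega
    have hm : maximalIdeal (X.presheaf.stalk ξ) = Ideal.span {x 0, y 0} := by
      rw [← hspan, Set.range_unique, Set.range_unique, Set.singleton_union]
      rfl
    refine ⟨x 0, y 0, hreg, hne hm, hm, Or.inl ?_⟩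
    rw [hI, Fin.prod_univ_one]
  · -- two branches: `r = 2`, `e = 0`
    obtain rfl : r = 2 := by omega
    obtain rfl : e = 0 := by omega
    have hm : maximalIdeal (X.presheaf.stalk ξ) = Ideal.span {x 0, x 1} := by
      rw [← hspan, Set.range_eq_empty y, Set.union_empty]
      congr 1
      ext a
      simp only [Set.mem_range, Fin.exists_fin_two, Set.mem_insert_iff, Set.mem_singleton_iff]
      constructor
      · rintro (h | h)
        · exact Or.inl h.symm
        · exact Or.inr h.symm
      · rintro (h | h)
        · exact Or.inl h.symm
        · exact Or.inr h.symm
    refine ⟨x 0, x 1, hreg, hne hm, hm, Or.inr ?_⟩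
    rw [hI, Fin.prod_univ_two]

/-- **(d1) The critical primes at a Giraud-singular point.** For `f ∈ Γ(X, 𝒪_X)` with `E(f)`
closed and strict normal crossings at `ξ`, `dim 𝒪_{X,ξ} = 2`, and `ξ` in an affine open `U` with
`Ω[Γ(X,U)⁄ℤ]` projective: there are regular parameters `x ≠ y`, `𝔪_ξ = (x, y)`, and EITHER
`I(E(f))_ξ = (x)` and `crit(𝒪_{X,ξ}, f_ξ) = {P prime, ht P = 1, x ∈ P}` (non-crossing point),
OR `I(E(f))_ξ = (x·y)` and `crit(𝒪_{X,ξ}, f_ξ) = {P prime, ht P = 1, x·y ∈ P}` (crossing point)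
— the inputs of `mem_derivCriticalPrimes_iff_of_rsop₁` / `…₂`.
[cite: Giraud1983, 1.3 and 2.2 (*)] -/
theorem exists_rsop_derivCriticalPrimes_of_isStrictNormalCrossingsAt {X : Scheme.{0}}
    {U : X.Opens} (hU : IsAffineOpen U) [Module.Projective Γ(X, U) Ω[Γ(X, U)⁄ℤ]] (f : Γ(X, ⊤))
    (hE : IsClosed (derivCriticalSet X f)) {ξ : X} (hξ : ξ ∈ U)
    (h : IsStrictNormalCrossingsAt X (derivCriticalSet X f) ξ)
    (hdim : ringKrullDim (X.presheaf.stalk ξ) = 2) :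
    ∃ x y : X.presheaf.stalk ξ, IsRegularLocalRing (X.presheaf.stalk ξ) ∧ x ≠ y ∧
      maximalIdeal (X.presheaf.stalk ξ) = Ideal.span {x, y} ∧
      ((stalkIdeal (vanishingIdeal ⟨derivCriticalSet X f, hE⟩) ξ = Ideal.span {x} ∧
        ∀ P : Ideal (X.presheaf.stalk ξ),
          P ∈ derivCriticalPrimes (X.presheaf.stalk ξ) (X.presheaf.germ ⊤ ξ trivial f) ↔
            P.IsPrime ∧ P.height = 1 ∧ x ∈ P) ∨
       (stalkIdeal (vanishingIdeal ⟨derivCriticalSet X f, hE⟩) ξ = Ideal.span {x * y} ∧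
        ∀ P : Ideal (X.presheaf.stalk ξ),
          P ∈ derivCriticalPrimes (X.presheaf.stalk ξ) (X.presheaf.germ ⊤ ξ trivial f) ↔
            P.IsPrime ∧ P.height = 1 ∧ x * y ∈ P)) := by
  obtain ⟨x, y, hreg, hxy, hm, hI⟩ :=
    exists_rsop_stalkIdeal_eq_of_isStrictNormalCrossingsAt hE h hdim
  refine ⟨x, y, hreg, hxy, hm, ?_⟩
  rcases hI with hI | hI
  · exact Or.inl ⟨hI, mem_derivCriticalPrimes_stalk_iff_of_eq_span hU f hE hξ hI⟩
  · exact Or.inr ⟨hI, mem_derivCriticalPrimes_stalk_iff_of_eq_span hU f hE hξ hI⟩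

end Summit.ResolutionOfSingularities.ResolutionOfSingularities.Theorems.RadicialJung.CleanModels.T2

end
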